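/-
Copyright (c) 2026. All rights reserved.
Released under Apache 2.0 license as described in the file LICENSE.
Authors: abc-iut cell, prover seat abc-iut-w5-d038 (gen 8; row «ARC-MTC-F3» (L4-lead m134), part F3a: the sign
`σ_𝕏 ∈ {±1}` comparing THE chart of `G_𝕏` with the CAF chart, and its naturality — the F2-independent layer of the
archimedean `η⊢_{v,ν}` of [AbsTopIII] Cor 5.10 (iv)(c)).
-/
import Literature.AnabelianGeometry.AbsoluteAnabelian.AutHolFieldFunctorMonoAnalyticization
import HarnessLib

/-!
# The chart sign `σ_𝕏` of `G_𝕏 = 𝒪^▷_{𝒜_𝕏}` and its naturality ([AbsTopIII] Prop 5.8 (iv)(v), Cor 5.10 (iv)(c) at arc)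

S. Mochizuki, *Topics in absolute anabelian geometry III*, Prop 5.8 (iv)/(v) p. 140 (the universal covering
`C∼ → C×` of a mono-analytic arch-theater and its functoriality «up to `±1`»), Cor 5.10 (iv)(c) p. 148 (the natural
isomorphism `η⊢_{v,ν}` comparing the two paths `γ¹_{v,ν}`, `γ⁰_{v,ν}` at an archimedean `v`), Rmk 5.8.1 (i) p. 142
(«forgetting the rigidification»: transition automorphisms are `id` or `conj`).  abc-iut-w6-d025's ARC-MTC spec
(HOME/staging/w6/w6-d025/g4/census/ARC-MTC-SPEC.md §F3): at an archimedean place the two sides of `η⊢_{v,ν}` are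
`ℝ × ℝ` (resp. `AddCircle × ℝ`) read through two INDEPENDENTLY CHOSEN charts of `G_𝕏` — THE chart
`TMMono.chart (toTMMonoObj 𝕏)` (abc-iut-w6-d025, p477125, `Classical.choose`) and the CAF chart `integralChart 𝕏`
(p478566) — so `η⊢` is `(s, t) ↦ (σ_𝕏 s, t)` for a sign `σ_𝕏`, natural in `𝕏` by uniqueness of signs.  This file is
that sign layer (independent of the `TH⊞`/`TB⊞` typing of abc-iut-L4-t8's F1/F2):

* `AutHolFieldFunctor.chartComparison X` — the bicontinuous automorphism `e_𝕏 ∘ chart_𝕏⁻¹` of `𝒪^▷_ℂ`;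
* `AutHolFieldFunctor.chartSign X` — `σ_𝕏 ∈ {±1}` (abc-iut-w6-d034's `exists_sign_of_mulEquiv_complexIntegralMonoid`),
  ★ `cafChart_cover : e_𝕏 (cover_𝕏 t) = e^{i σ_𝕏 t}` (the covering coordinate of THE chart read in the CAF chart);
* `AutHolFieldFunctor.transitionSign f` — `ε_f ∈ {±1}`, `= 1` iff the transition automorphism `e_𝕐 ∘ 𝒜_f ∘ e_𝕏⁻¹` is
  the identity (else `conj`, `transition_eq_id_or_conj`); `cafChart_Amap_exp_mul_I : e_𝕐(𝒜_f (e_𝕏⁻¹ e^{ix})) = e^{i ε_f x}`;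
* ★★ `chartSign_mul_sign_eq : σ_𝕐 · sign (toTMMono.map f) = ε_f · σ_𝕏` — NATURALITY of the sign (the content of the
  naturality square of `η⊢_{v,ν}` in 𝕏; `TMMono.map_cover`, `TMMono.sign_unique_aux`).

Three small definitions (the comparison, the two signs: data the `η⊢` isomorphism needs), everything else proved;
no instance, no named fact.  MODEL-LEVEL (the Aut-holomorphic model `𝔄`); refereed pre-IUT material; nothing here
bears on the disputed [IUTchIII] Cor. 3.12; typed ≠ proved.
-/

set_option autoImplicit false

noncomputable section

open CategoryTheory Complex

universe u

namespace Literature.AnabelianGeometry.AbsoluteAnabelian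

namespace AutHolFieldFunctor

variable (𝔄 : AutHolFieldFunctor.{u})

/-! ## §1 The comparison of the two charts of `G_𝕏` and its sign `σ_𝕏` -/

/-- **The comparison automorphism `e_𝕏 ∘ chart_𝕏⁻¹` of `𝒪^▷_ℂ`**: THE chart of `G_𝕏` (Prop 5.8 (iv), chosen once by
`Classical.choose`) followed backwards by the CAF chart `integralChart 𝕏`. [cite: MochizukiAbsTopIII2015, Prop 5.8 (iv) p.140] -/
def chartComparison (X : 𝔄.EA) : complexIntegralMonoid ≃* complexIntegralMonoid :=
  (𝔄.toTMMonoObj X).chart.symm.trans (MulEquiv.ulift.trans (𝔄.integralChart X))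

/-- The comparison is continuous. [cite: MochizukiAbsTopIII2015, Prop 5.8 (iv) p.140] -/
theorem continuous_chartComparison (X : 𝔄.EA) : Continuous (𝔄.chartComparison X) :=
  (𝔄.continuous_integralChart X).comp (continuous_uliftDown.comp (𝔄.toTMMonoObj X).continuous_chart_symm)

/-- … and so is its inverse. [cite: MochizukiAbsTopIII2015, Prop 5.8 (iv) p.140] -/
theorem continuous_chartComparison_symm (X : 𝔄.EA) : Continuous (𝔄.chartComparison X).symm :=
  (𝔄.toTMMonoObj X).continuous_chart.comp (continuous_uliftUp.comp (𝔄.continuous_integralChart_symm X))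

/-- The comparison on elements: `e_𝕏` of the point `chart_𝕏⁻¹ z` of `G_𝕏`. [cite: MochizukiAbsTopIII2015, Prop 5.8 (iv) p.140] -/
theorem chartComparison_apply_coe (X : 𝔄.EA) (z : complexIntegralMonoid) :
    ((𝔄.chartComparison X z : complexIntegralMonoid) : ℂ) =
      𝔄.cafChart X (((𝔄.toTMMonoObj X).chart.symm z).down : ↥(𝔄.integralMonoid X)).1 := rfl

/-- The sign exists: `e_𝕏 ∘ chart_𝕏⁻¹` is `id` or `conj` on the circle, `e^{it} ↦ e^{iσt}`.
[cite: MochizukiAbsTopIII2015, Prop 5.8 (v) p.140] -/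
theorem exists_chartSign (X : 𝔄.EA) : ∃ σ : ℝ, (σ = 1 ∨ σ = -1) ∧ ∀ t : ℝ,
    ((𝔄.chartComparison X (TMMono.expPt t) : complexIntegralMonoid) : ℂ) = Complex.exp (↑(σ * t) * I) :=
  exists_sign_of_mulEquiv_complexIntegralMonoid (𝔄.chartComparison X) (𝔄.continuous_chartComparison X)
    (𝔄.continuous_chartComparison_symm X)

/-- **The chart sign `σ_𝕏 ∈ {±1}`** of `G_𝕏`: THE chart and the CAF chart differ by `id` (`σ_𝕏 = 1`) or `conj`
(`σ_𝕏 = -1`) on the universal covering coordinate. [cite: MochizukiAbsTopIII2015, Prop 5.8 (v) p.140] -/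
def chartSign (X : 𝔄.EA) : ℝ := Classical.choose (𝔄.exists_chartSign X)

/-- `σ_𝕏 = ±1`. [cite: MochizukiAbsTopIII2015, Prop 5.8 (v) p.140] -/
theorem chartSign_eq_one_or (X : 𝔄.EA) : 𝔄.chartSign X = 1 ∨ 𝔄.chartSign X = -1 :=
  (Classical.choose_spec (𝔄.exists_chartSign X)).1

/-- `σ_𝕏² = 1`. [cite: MochizukiAbsTopIII2015, Prop 5.8 (v) p.140] -/
theorem chartSign_mul_self (X : 𝔄.EA) : 𝔄.chartSign X * 𝔄.chartSign X = 1 := by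
  rcases 𝔄.chartSign_eq_one_or X with h | h <;> rw [h] <;> norm_num

/-- ★ **THE chart's covering coordinate read in the CAF chart**: `e_𝕏 (cover_𝕏 t) = e^{i σ_𝕏 t}` for the universal
covering `t ↦ cover_𝕏 t = chart_𝕏⁻¹(e^{it})` of Prop 5.8 (iv). [cite: MochizukiAbsTopIII2015, Prop 5.8 (iv) p.140] -/
theorem cafChart_cover (X : 𝔄.EA) (t : ℝ) :
    𝔄.cafChart X (((𝔄.toTMMonoObj X).cover t).down : ↥(𝔄.integralMonoid X)).1 =
      Complex.exp (↑(𝔄.chartSign X * t) * I) := by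
  have h := (Classical.choose_spec (𝔄.exists_chartSign X)).2 t
  rw [chartComparison_apply_coe] at h
  exact h

/-! ## §2 The transition sign `ε_f` of a morphism of `EA` -/

variable {𝔄}

open Classical in
/-- **The transition sign `ε_f ∈ {±1}`** of `f : 𝕏 → 𝕐`: `1` if the transition automorphism `e_𝕐 ∘ 𝒜_f ∘ e_𝕏⁻¹` of `ℂ`
is the identity, `-1` if it is complex conjugation (Rmk 5.8.1 (i): these are the only cases).
[cite: MochizukiAbsTopIII2015, Rmk 5.8.1 (i) p.142] -/
def transitionSign {X Y : 𝔄.EA} (f : X ⟶ Y) : ℝ :=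
  if (transition f).toRingHom = RingHom.id ℂ then 1 else -1

/-- `ε_f = ±1`. [cite: MochizukiAbsTopIII2015, Rmk 5.8.1 (i) p.142] -/
theorem transitionSign_eq_one_or {X Y : 𝔄.EA} (f : X ⟶ Y) : transitionSign f = 1 ∨ transitionSign f = -1 := by
  unfold transitionSign
  split_ifs
  · exact Or.inl rfl
  · exact Or.inr rfl

/-- **`𝒜_f` on the circle, read in the charts**: `e_𝕐 (𝒜_f a) = e^{i ε_f x}` whenever `e_𝕏 a = e^{ix}` (`x` real).
[cite: MochizukiAbsTopIII2015, Rmk 5.8.1 (i) p.142] -/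
theorem cafChart_Amap_of_eq_exp {X Y : 𝔄.EA} (f : X ⟶ Y) {a : 𝔄.A X} {x : ℝ}
    (ha : 𝔄.cafChart X a = Complex.exp (↑x * I)) :
    𝔄.cafChart Y (𝔄.Amap f a) = Complex.exp (↑(transitionSign f * x) * I) := by
  rw [← transition_apply_cafChart, ha]
  unfold transitionSign
  rcases transition_eq_id_or_conj f with h | h
  · rw [if_pos h, one_mul]
    exact (RingHom.congr_fun h (Complex.exp (↑x * I)) : _)
  · have hne : (transition f).toRingHom ≠ RingHom.id ℂ := by
      rw [h]
      intro hc
      have := RingHom.congr_fun hc I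
      simp [Complex.ext_iff] at this
      norm_num at this
    rw [if_neg hne]
    have e1 : (transition f) (Complex.exp (↑x * I)) = starRingEnd ℂ (Complex.exp (↑x * I)) := by
      have h' := RingHom.congr_fun h (Complex.exp (↑x * I))
      exact h'
    rw [e1, ← Complex.exp_conj, map_mul, Complex.conj_ofReal, Complex.conj_I]
    congr 1
    push_cast
    ring

/-! ## §3 Naturality of the chart sign -/

/-- ★★ **Naturality of `σ_𝕏`**: for `f : 𝕏 → 𝕐` in `EA`, `σ_𝕐 · sign(G_f) = ε_f · σ_𝕏`, where `sign(G_f)` is the sign of the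
morphism `G_f = toTMMono.map f` of `TM⊢` (Prop 5.8 (v): `G_f` lifts to `t ↦ sign(G_f)·t` on the universal coverings) and
`ε_f` the transition sign.  Both sides are the exponent of `e_𝕐(𝒜_f(cover_𝕏 t))`: through THE charts it is
`σ_𝕐 · sign(G_f) · t`, through the CAF charts `ε_f · σ_𝕏 · t`; signs on `e^{it}` are unique.  This is the naturality
square of the archimedean `η⊢_{v,ν}` of Cor 5.10 (iv)(c). [cite: MochizukiAbsTopIII2015, Cor 5.10 (iv)(c) p.148] -/
theorem chartSign_mul_sign_eq {X Y : 𝔄.EA} (f : X ⟶ Y) :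
    𝔄.chartSign Y * TMMono.sign (𝔄.toTMMono.map f) = transitionSign f * 𝔄.chartSign X := by
  -- `e_𝕐 (𝒜_f (cover_𝕏 t))` computed in the two ways
  have key : ∀ t : ℝ, Complex.exp (↑(𝔄.chartSign Y * TMMono.sign (𝔄.toTMMono.map f) * t) * I) =
      Complex.exp (↑(transitionSign f * 𝔄.chartSign X * t) * I) := by
    intro t
    -- through THE charts: `G_f (cover_𝕏 t) = cover_𝕐 (sign t)`
    have h1 : 𝔄.cafChart Y (((𝔄.toTMMono.map f).toMulEquiv ((𝔄.toTMMonoObj X).cover t)).down :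
        ↥(𝔄.integralMonoid Y)).1 =
        Complex.exp (↑(𝔄.chartSign Y * TMMono.sign (𝔄.toTMMono.map f) * t) * I) := by
      have hc := TMMono.map_cover (𝔄.toTMMono.map f) t
      change (𝔄.toTMMono.map f).toMulEquiv ((𝔄.toTMMonoObj X).cover t) = (𝔄.toTMMonoObj Y).cover _ at hc
      rw [hc, cafChart_cover, mul_assoc]
    -- through the CAF charts: `𝒜_f` acts by the transition
    have h2 : 𝔄.cafChart Y (((𝔄.toTMMono.map f).toMulEquiv ((𝔄.toTMMonoObj X).cover t)).down :
        ↥(𝔄.integralMonoid Y)).1 =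
        Complex.exp (↑(transitionSign f * 𝔄.chartSign X * t) * I) := by
      have happ : (((𝔄.toTMMono.map f).toMulEquiv ((𝔄.toTMMonoObj X).cover t)).down :
          ↥(𝔄.integralMonoid Y)).1 =
          𝔄.Amap f (((𝔄.toTMMonoObj X).cover t).down : ↥(𝔄.integralMonoid X)).1 := rfl
      rw [happ, cafChart_Amap_of_eq_exp f (𝔄.cafChart_cover X t), mul_assoc]
    rw [← h1, h2]
  -- uniqueness of signs on `e^{it}` at `t = π/2`
  have hσ : 𝔄.chartSign Y * TMMono.sign (𝔄.toTMMono.map f) = 1 ∨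
      𝔄.chartSign Y * TMMono.sign (𝔄.toTMMono.map f) = -1 := by
    rcases 𝔄.chartSign_eq_one_or Y with h | h <;> rcases TMMono.sign_eq_one_or (𝔄.toTMMono.map f) with h' | h' <;>
      rw [h, h'] <;> norm_num
  have hσ' : transitionSign f * 𝔄.chartSign X = 1 ∨ transitionSign f * 𝔄.chartSign X = -1 := by
    rcases transitionSign_eq_one_or f with h | h <;> rcases 𝔄.chartSign_eq_one_or X with h' | h' <;>
      rw [h, h'] <;> norm_num
  refine TMMono.sign_unique_aux hσ hσ' (Subtype.ext ?_)
  change Complex.exp (↑(𝔄.chartSign Y * TMMono.sign (𝔄.toTMMono.map f) * (Real.pi / 2)) * I) =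
    Complex.exp (↑(transitionSign f * 𝔄.chartSign X * (Real.pi / 2)) * I)
  exact key (Real.pi / 2)

/-- The same naturality, solved for the sign of `G_f`: `sign(G_f) = ε_f · σ_𝕏 · σ_𝕐` (all signs are `±1`).
[cite: MochizukiAbsTopIII2015, Cor 5.10 (iv)(c) p.148] -/
theorem sign_toTMMono_map_eq {X Y : 𝔄.EA} (f : X ⟶ Y) :
    TMMono.sign (𝔄.toTMMono.map f) = transitionSign f * 𝔄.chartSign X * 𝔄.chartSign Y := by
  have h := chartSign_mul_sign_eq f
  have hY := 𝔄.chartSign_mul_self Y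
  calc TMMono.sign (𝔄.toTMMono.map f)
      = (𝔄.chartSign Y * 𝔄.chartSign Y) * TMMono.sign (𝔄.toTMMono.map f) := by rw [hY, one_mul]
    _ = 𝔄.chartSign Y * (𝔄.chartSign Y * TMMono.sign (𝔄.toTMMono.map f)) := by ring
    _ = 𝔄.chartSign Y * (transitionSign f * 𝔄.chartSign X) := by rw [h]
    _ = transitionSign f * 𝔄.chartSign X * 𝔄.chartSign Y := by ring

/-- For an ENDOMORPHISM the chart signs cancel: `sign(G_f) = ε_f` (Rmk 5.8.1 (i): an automorphism of `𝕏` acts on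
`G_𝕏` by its transition `∈ {id, conj}`). [cite: MochizukiAbsTopIII2015, Rmk 5.8.1 (i) p.142] -/
theorem sign_toTMMono_map_eq_transitionSign {X : 𝔄.EA} (f : X ⟶ X) :
    TMMono.sign (𝔄.toTMMono.map f) = transitionSign f := by
  rw [sign_toTMMono_map_eq, mul_assoc, 𝔄.chartSign_mul_self X, mul_one]

end AutHolFieldFunctor

end Literature.AnabelianGeometry.AbsoluteAnabelian

end
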